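import Mathlib.Combinatorics.Enumerative.DoubleCounting
import Mathlib.GroupTheory.SpecificGroups.Dihedral
import Mathlib.GroupTheory.SpecificGroups.Quaternion
import Literature.Combinatorics.Additive.TripleProductPropertySAT
import Literature.Computability.AlgebraicComplexity.TPPGroupExtension
import Summits.MatrixMultiplication.OmegaCensus.CentreIndexSixModel
import Summits.MatrixMultiplication.OmegaCensus.CentreIndexSixCoord

/-!
# ω-census, family (b3): no TPP triple with two `3`-sets beats `Σ d³` when the centre has index `6`

HONEST FRAMING (pub-omega census; verbatim): lottery ticket; floor = certified bounds/negative ranges.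
Census BOOKKEEPING (prereg P-028 of the cell, items .3/.4): a certified NEGATIVE RANGE for single TPP triples; it contains the
machine box constants `α_{S₃} = 10` (`S3BoxIndependence.lean`, NR138) and `α_{Dic₃} = 20` (the deferred `Dic3Box*` chain) as
instances.  Nothing here is progress on `ω`.

STATEMENT (`Coord.three_mul_volume_le`).  In a finite group with coordinates `Coord c κ ε` (`CentreIndexSixCoord.lean`: the groups
`C₃ ⋊_ε C` with `C` abelian, in particular every group whose centre has index `6` — `S₃`, `Dic₃`, `D₆`, `C₃ ⋊ C₈`, `S₃ × A`, `Dic₃ × A`, …;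
`CentreIndexSixGroups.lean` derives the package from `(center G).index = 6`) every TPP triple `(S, T, U)` with `|T|, |U| ≤ 3` has
`3·|S||T||U| ≤ 5·|G|` (`= 3·Σ_χ χ(1)³` when `[G : Z(G)] = 6`).  Hence
(`not_realizesTPP_three_three`) NO `⟨N, 3, 3⟩` in any order when `5|G| < 27N` — Neumann's universal bound is `5N ≤ |G|`; e.g. the
census cell `(34, 3, 3) ∉ Dic₃ × C₁₅` (`918 > 900`, `Dic3xC15_no_tpp_34_3_3`).
PROOF.  W.l.o.g. `1 ∈ T ∩ U` (tree `exists_basic_tpp`).  Count each cell `P = (x, y, w)` of `S × T × U` at the three points of the coset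
`x y w · K`, `K = {1, c, c²} = G'`: `3|S||T||U| = Σ_g #(fibre of g)`.  FIBRE LEMMA (`fibre_le_five`): a fibre holds at most `5` cells —
two distinct cells of one fibre have both TPP words in `K` (`CentreIndexSixCoord.inK_E`) and non-trivial (TPP), and by the fibre word
formula the `c`-exponent of a word is `ε_y ε_w (λ_P − λ_{P'} + ε_{y'} ε_{w'} B(p, p'))`; so `P ↦ (position, normalised lift λ_P)` maps the
fibre injectively onto an independent set of the `27`-vertex model graph of the label configuration of `(t₁, t₂, u₁, u₂)`
(`CentreIndexSixModel.adj_spec`, `dn_cast`), which has at most `5` elements by the kernel certificate `CentreIndexSixModel.cert_all`.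
Pre-registered as the MECHANISM of census prereg P-028 and confirmed before the kernel by two exact engines (`α = (5/3)|G|` on eight
groups of orders `6–48`) and an exhaustive finite model; elementary new mathematics of the cell (pub-omega stpp-1 gen 12/13), not a
published statement: it lives under `Summits/`, not `Literature/`.
-/

open Finset
open Literature.Combinatorics.Additive

namespace Summit.MatrixMultiplication.OmegaCensus.CentreIndexSix

variable {G : Type*} [Group G]

/-- The coordinate of a label is `κ`. [folklore] -/
theorem kOf_lab {α : Type*} (κ ε : α → ZMod 3) (y : α) : kOf (lab κ ε y) = κ y := by
  unfold kOf lab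
  have hv := (κ y).val_lt
  have : ((κ y).val + if ε y = 1 then 0 else 3) % 3 = (κ y).val := by split_ifs <;> omega
  rw [this, ZMod.natCast_zmod_val]

namespace Coord

variable {c : G} {κ ε : G → ZMod 3} (h : Coord c κ ε)
include h

/-- The sign of a label is `ε`. [folklore] -/
theorem eOf_lab (y : G) : eOf (lab κ ε y) = ε y := by
  unfold eOf lab
  have hv := (κ y).val_lt
  rcases h.sign y with e | e
  · rw [if_pos e, if_pos (by omega), e]
  · have hne : ε y ≠ 1 := by rw [e]; decide
    rw [if_neg hne, if_neg (by omega), e]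

/-! ### The fibre lemma: at most five cells of a TPP box in a coset fibre -/

/-- **Fibre lemma.** With `T ⊆ {1, t₁, t₂}`, `U ⊆ {1, u₁, u₂}` and `(S, T, U)` a TPP triple, at most `5` cells of
`S × T × U` lie in one fibre `{P : g⁻¹ · key P ∈ K}` — they map injectively onto an independent set of the model graph of the
label configuration, which the certificate bounds. [folklore] -/
theorem fibre_le_five [DecidableEq G] {S T U : Finset G} (htpp : TripleProductProperty S T U) {t₁ t₂ u₁ u₂ : G}
    (hT : ∀ y ∈ T, y = 1 ∨ y = t₁ ∨ y = t₂) (hU : ∀ w ∈ U, w = 1 ∨ w = u₁ ∨ w = u₂) (h12 : lab κ ε t₁ ≤ lab κ ε t₂)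
    (h34 : lab κ ε u₁ ≤ lab κ ε u₂) (g : G) {J : Finset (G × G × G)} (hJV : J ⊆ S ×ˢ (T ×ˢ U))
    (hJg : ∀ P ∈ J, InK c (g⁻¹ * key P)) : #J ≤ 5 := by
  classical
  -- the configuration
  have hl1 := lab_lt κ ε t₁; have hl2 := lab_lt κ ε t₂; have hl3 := lab_lt κ ε u₁; have hl4 := lab_lt κ ε u₂
  set n : ℕ := lab κ ε t₁ + 6 * lab κ ε t₂ + 36 * lab κ ε u₁ + 216 * lab κ ε u₂ with hn
  have hn' : n < 1296 := by omega
  have hsort : sorted n = true := by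
    simp only [sorted, Bool.and_eq_true, decide_eq_true_eq]; omega
  have hT1 : labT n 1 = lab κ ε t₁ := by simp [labT]; omega
  have hT2 : labT n 2 = lab κ ε t₂ := by simp [labT]; omega
  have hU1 : labU n 1 = lab κ ε u₁ := by simp [labU]; omega
  have hU2 : labU n 2 = lab κ ε u₂ := by simp [labU]; omega
  have hT0 : labT n 0 = lab κ ε 1 := by rw [h.lab_one]; simp [labT]
  have hU0 : labU n 0 = lab κ ε 1 := by rw [h.lab_one]; simp [labU]
  -- position indices
  let iT : G → ℕ := fun y => if y = 1 then 0 else if y = t₁ then 1 else 2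
  let iU : G → ℕ := fun w => if w = 1 then 0 else if w = u₁ then 1 else 2
  have selT : ∀ y ∈ T, (iT y = 0 ∧ y = 1) ∨ (iT y = 1 ∧ y = t₁) ∨ (iT y = 2 ∧ y = t₂) := by
    intro y hy; simp only [iT]
    split_ifs with h1 h2
    · exact Or.inl ⟨rfl, h1⟩
    · exact Or.inr (Or.inl ⟨rfl, h2⟩)
    · rcases hT y hy with e | e | e
      · exact absurd e h1
      · exact absurd e h2
      · exact Or.inr (Or.inr ⟨rfl, e⟩)
  have selU : ∀ w ∈ U, (iU w = 0 ∧ w = 1) ∨ (iU w = 1 ∧ w = u₁) ∨ (iU w = 2 ∧ w = u₂) := by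
    intro w hw; simp only [iU]
    split_ifs with h1 h2
    · exact Or.inl ⟨rfl, h1⟩
    · exact Or.inr (Or.inl ⟨rfl, h2⟩)
    · rcases hU w hw with e | e | e
      · exact absurd e h1
      · exact absurd e h2
      · exact Or.inr (Or.inr ⟨rfl, e⟩)
  have labT_iT : ∀ y ∈ T, iT y < 3 ∧ labT n (iT y) = lab κ ε y := by
    intro y hy
    rcases selT y hy with ⟨e, rfl⟩ | ⟨e, rfl⟩ | ⟨e, rfl⟩ <;> rw [e]
    exacts [⟨by omega, hT0⟩, ⟨by omega, hT1⟩, ⟨by omega, hT2⟩]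
  have labU_iU : ∀ w ∈ U, iU w < 3 ∧ labU n (iU w) = lab κ ε w := by
    intro w hw
    rcases selU w hw with ⟨e, rfl⟩ | ⟨e, rfl⟩ | ⟨e, rfl⟩ <;> rw [e]
    exacts [⟨by omega, hU0⟩, ⟨by omega, hU1⟩, ⟨by omega, hU2⟩]
  have injT : ∀ y ∈ T, ∀ y' ∈ T, iT y = iT y' → y = y' := by
    intro y hy y' hy' e
    rcases selT y hy with ⟨e1, f1⟩ | ⟨e1, f1⟩ | ⟨e1, f1⟩ <;>
      rcases selT y' hy' with ⟨e2, f2⟩ | ⟨e2, f2⟩ | ⟨e2, f2⟩ <;> first | (rw [f1, f2]; done) | omega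
  have injU : ∀ w ∈ U, ∀ w' ∈ U, iU w = iU w' → w = w' := by
    intro w hw w' hw' e
    rcases selU w hw with ⟨e1, f1⟩ | ⟨e1, f1⟩ | ⟨e1, f1⟩ <;>
      rcases selU w' hw' with ⟨e2, f2⟩ | ⟨e2, f2⟩ | ⟨e2, f2⟩ <;> first | (rw [f1, f2]; done) | omega
  -- the vertex map
  let lam : G × G × G → ZMod 3 := fun P => ε P.2.1 * ε P.2.2 * κ P.1
  let φ : G × G × G → ℕ := fun P => 3 * (3 * iT P.2.1 + iU P.2.2) + (lam P).val
  have memV : ∀ P ∈ J, P.1 ∈ S ∧ P.2.1 ∈ T ∧ P.2.2 ∈ U := fun P hP => by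
    have := hJV hP; rw [mem_product, mem_product] at this; exact ⟨this.1, this.2.1, this.2.2⟩
  have φdiv : ∀ P ∈ J, φ P < 27 ∧ φ P / 3 / 3 = iT P.2.1 ∧ φ P / 3 % 3 = iU P.2.2 ∧ φ P % 3 = (lam P).val := by
    intro P hP
    obtain ⟨-, hy, hw⟩ := memV P hP
    have h1 := (labT_iT _ hy).1; have h2 := (labU_iU _ hw).1; have h3 := (lam P).val_lt
    simp only [φ]; omega
  -- independence: a flagged pair of distinct cells contradicts the TPP
  have indep : ∀ P ∈ J, ∀ P' ∈ J, P ≠ P' → (adjRow (packAdj n) (φ P)).testBit (φ P') = false := by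
    rintro ⟨x, y, w⟩ hP ⟨x', y', w'⟩ hP' hne
    rw [Bool.eq_false_iff]
    intro hbit
    obtain ⟨hxS, hyT, hwU⟩ := memV _ hP
    obtain ⟨hxS', hyT', hwU'⟩ := memV _ hP'
    obtain ⟨-, hpos, hcase⟩ := adj_spec hbit
    obtain ⟨-, d1, d2, d3⟩ := φdiv _ hP
    obtain ⟨-, d1', d2', d3'⟩ := φdiv _ hP'
    simp only at d1 d2 d3 d1' d2' d3'
    rw [dpp, dpp, d1, d2, d3, d1', d2', d3', (labT_iT y hyT).2, (labT_iT y' hyT').2, (labU_iU w hwU).2,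
      (labU_iU w' hwU').2] at hcase
    have hu := hJg _ hP; have hu' := hJg _ hP'
    simp only [key] at hu hu'
    have h3 : (3 : ZMod 3) = 0 := by decide
    rcases hcase with e | e
    · -- `λ' ≡ λ − σ' B`: the word `E(P, P')` has exponent `0`, hence is trivial
      have hd := dn_cast _ (lab_lt κ ε y) _ (lab_lt κ ε y') _ (lab_lt κ ε w) _ (lab_lt κ ε w')
      rw [kOf_lab, kOf_lab, kOf_lab, kOf_lab, h.eOf_lab, h.eOf_lab, h.eOf_lab, h.eOf_lab] at hd
      have el : lam (x', y', w') = lam (x, y, w) + 2 * ((dn (lab κ ε y) (lab κ ε y') (lab κ ε w) (lab κ ε w') : ℕ) : ZMod 3) := by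
        rw [← ZMod.natCast_zmod_val (lam (x', y', w')), e, ZMod.natCast_mod]; push_cast; rw [ZMod.natCast_zmod_val]
      rw [hd] at el
      simp only [lam] at el
      have hk : κ (E (x, y, w) (x', y', w')) = 0 := by
        rw [h.kap_E_fibre hu hu', el]; linear_combination (ε y * ε w * (ε y' * ε w') *
          (κ y - ε y * ε y' * κ y' + ε y * ε y' * (κ w - ε w * ε w' * κ w'))) * h3
      have hE := h.inK_eq_one (h.inK_E hu hu') hk
      obtain ⟨ex, ey, ew⟩ := htpp x hxS x' hxS' y hyT y' hyT' w hwU w' hwU' hE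
      exact hne (by rw [ex, ey, ew])
    · -- `λ' ≡ λ + d(p', p)`: the word `E(P', P)` is trivial
      have hd := dn_cast _ (lab_lt κ ε y') _ (lab_lt κ ε y) _ (lab_lt κ ε w') _ (lab_lt κ ε w)
      rw [kOf_lab, kOf_lab, kOf_lab, kOf_lab, h.eOf_lab, h.eOf_lab, h.eOf_lab, h.eOf_lab] at hd
      have el : lam (x', y', w') = lam (x, y, w) + ((dn (lab κ ε y') (lab κ ε y) (lab κ ε w') (lab κ ε w) : ℕ) : ZMod 3) := by
        rw [← ZMod.natCast_zmod_val (lam (x', y', w')), e, ZMod.natCast_mod]; push_cast; rw [ZMod.natCast_zmod_val]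
      rw [hd] at el
      simp only [lam] at el
      have hk : κ (E (x', y', w') (x, y, w)) = 0 := by
        rw [h.kap_E_fibre hu' hu, el]; ring
      have hE := h.inK_eq_one (h.inK_E hu' hu) hk
      obtain ⟨ex, ey, ew⟩ := htpp x' hxS' x hxS y' hyT' y hyT w' hwU' w hwU hE
      exact hne (by rw [ex, ey, ew])
  -- injectivity: position and normalised lift determine the cell inside a fibre
  have inj : Set.InjOn φ J := by
    rintro ⟨x, y, w⟩ hP ⟨x', y', w'⟩ hP' e
    obtain ⟨hxS, hyT, hwU⟩ := memV _ hP
    obtain ⟨hxS', hyT', hwU'⟩ := memV _ hP'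
    obtain ⟨-, d1, d2, d3⟩ := φdiv _ hP
    obtain ⟨-, d1', d2', d3'⟩ := φdiv _ hP'
    simp only at d1 d2 d3 d1' d2' d3' e
    have ey : y = y' := injT y hyT y' hyT' (by rw [← d1, ← d1', e])
    have ew : w = w' := injU w hwU w' hwU' (by rw [← d2, ← d2', e])
    subst ey ew
    have el : lam (x, y, w) = lam (x', y, w) := ZMod.val_injective 3 (by rw [← d3, ← d3', e])
    simp only [lam] at el
    have hκ : κ x = κ x' := by
      linear_combination (ε y * ε w) * el + (-(ε w * ε w * (κ x - κ x'))) * h.eps_sq y + (-(κ x - κ x')) * h.eps_sq w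
    have hu := hJg _ hP; have hu' := hJg _ hP'
    simp only [key] at hu hu'
    have hεx : ε x = ε x' := by rw [h.eps_of_fibre hu, h.eps_of_fibre hu']
    have e1 : κ (g⁻¹ * (x * y * w)) = κ g⁻¹ + ε g⁻¹ * (κ x + ε x * κ y + ε x * ε y * κ w) := by
      simp only [h.kap_mul, h.eps_mul]
    have e2 : κ (g⁻¹ * (x' * y * w)) = κ g⁻¹ + ε g⁻¹ * (κ x' + ε x' * κ y + ε x' * ε y * κ w) := by
      simp only [h.kap_mul, h.eps_mul]
    rw [hκ, hεx, ← e2] at e1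
    have := mul_left_cancel (h.inK_eq_of_kap hu hu' e1)
    rw [mul_right_cancel (mul_right_cancel this)]
  -- count through the certificate
  have hI := indep_card_le_five hn' hsort (J.image φ)
    (by
      intro a ha b hb hab
      obtain ⟨P, hP, rfl⟩ := mem_image.1 ha
      obtain ⟨P', hP', rfl⟩ := mem_image.1 hb
      exact indep P hP P' hP' fun e => hab (by rw [e]))
    (by
      intro a ha
      obtain ⟨P, hP, rfl⟩ := mem_image.1 ha
      exact (φdiv P hP).1)
  rwa [card_image_of_injOn inj] at hI

/-! ### The theorem -/

/-- Basic case (`1 ∈ T`, `1 ∈ U`): `3·|S||T||U| ≤ 5·|G|`, counting each cell at the three points of `key P · K`. [folklore] -/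
theorem three_mul_volume_le_basic [Fintype G] [DecidableEq G] {S T U : Finset G} (htpp : TripleProductProperty S T U)
    (hT : #T ≤ 3) (hU : #U ≤ 3) (h1T : (1 : G) ∈ T) (h1U : (1 : G) ∈ U) : 3 * (#S * #T * #U) ≤ 5 * Fintype.card G := by
  classical
  -- `T ⊆ {1, t₁, t₂}`, `U ⊆ {1, u₁, u₂}` with sorted labels
  obtain ⟨t₁, t₂, hT', h12⟩ : ∃ a b : G, (∀ y ∈ T, y = 1 ∨ y = a ∨ y = b) ∧ lab κ ε a ≤ lab κ ε b := by
    obtain ⟨a, b, hab⟩ := exists_cover_three hT h1T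
    rcases le_total (lab κ ε a) (lab κ ε b) with hle | hle
    · exact ⟨a, b, hab, hle⟩
    · exact ⟨b, a, fun y hy => (hab y hy).imp_right Or.symm, hle⟩
  obtain ⟨u₁, u₂, hU', h34⟩ : ∃ a b : G, (∀ y ∈ U, y = 1 ∨ y = a ∨ y = b) ∧ lab κ ε a ≤ lab κ ε b := by
    obtain ⟨a, b, hab⟩ := exists_cover_three hU h1U
    rcases le_total (lab κ ε a) (lab κ ε b) with hle | hle
    · exact ⟨a, b, hab, hle⟩
    · exact ⟨b, a, fun y hy => (hab y hy).imp_right Or.symm, hle⟩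
  set V : Finset (G × G × G) := S ×ˢ (T ×ˢ U) with hV
  have hcardV : #V = #S * #T * #U := by rw [hV, card_product, card_product, mul_assoc]
  let r : (G × G × G) → G → Prop := fun P g => InK c (g⁻¹ * key P)
  have hL : ∀ P ∈ V, #((univ : Finset G).bipartiteAbove r P) = 3 := by
    intro P _
    have hset : (univ : Finset G).bipartiteAbove r P = {key P, key P * (c * c), key P * c} := by
      ext g'
      simp only [bipartiteAbove, mem_filter, mem_univ, true_and, mem_insert, mem_singleton, r, InK]
      constructor
      · rintro (e | e | e)
        · left
          calc g' = g' * 1 := (mul_one _).symm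
            _ = g' * (g'⁻¹ * key P) := by rw [e]
            _ = key P := by group
        · right; left
          calc g' = key P * (g'⁻¹ * key P)⁻¹ := by group
            _ = key P * (c * c) := by rw [e, inv_eq_of_mul_eq_one_right h.c_mul_cc]
        · right; right
          calc g' = key P * (g'⁻¹ * key P)⁻¹ := by group
            _ = key P * c := by rw [e, inv_eq_of_mul_eq_one_right h.ccc]
      · rintro (rfl | rfl | rfl)
        · left; group
        · right; left
          calc (key P * (c * c))⁻¹ * key P = (c * c)⁻¹ := by group
            _ = c := inv_eq_of_mul_eq_one_right h.ccc
        · right; right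
          calc (key P * c)⁻¹ * key P = c⁻¹ := by group
            _ = c * c := inv_eq_of_mul_eq_one_right h.c_mul_cc
    rw [hset, card_insert_of_notMem, card_insert_of_notMem, card_singleton]
    · simp only [mem_singleton]
      exact fun e => h.c_ne_cc (mul_left_cancel e).symm
    · simp only [mem_insert, mem_singleton, not_or]
      exact ⟨fun e => h.cc_ne_one (mul_left_cancel (a := key P) (by rw [mul_one]; exact e.symm)),
        fun e => h.c_ne_one (mul_left_cancel (a := key P) (by rw [mul_one]; exact e.symm))⟩
  have hR : ∀ g ∈ (univ : Finset G), #(V.bipartiteBelow r g) ≤ 5 := fun g _ =>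
    h.fibre_le_five htpp hT' hU' h12 h34 g (filter_subset _ _) fun P hP => (mem_filter.1 hP).2
  calc 3 * (#S * #T * #U) = ∑ P ∈ V, #((univ : Finset G).bipartiteAbove r P) := by rw [sum_const_nat hL, hcardV, mul_comm]
    _ = ∑ g ∈ (univ : Finset G), #(V.bipartiteBelow r g) := sum_card_bipartiteAbove_eq_sum_card_bipartiteBelow _
    _ ≤ ∑ g ∈ (univ : Finset G), 5 := sum_le_sum hR
    _ = 5 * Fintype.card G := by rw [sum_const, card_univ, smul_eq_mul, mul_comm]


/-- **No two-`3`-set TPP triple beats `Σ d³` (centre of index `6`).**  In a finite group with coordinates `Coord c κ ε`, every TPP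
triple `(S, T, U)` with `|T| ≤ 3`, `|U| ≤ 3` has `3·|S||T||U| ≤ 5·|G|`. [folklore] -/
theorem three_mul_volume_le [Fintype G] [DecidableEq G] {S T U : Finset G} (htpp : TripleProductProperty S T U) (hT : #T ≤ 3)
    (hU : #U ≤ 3) : 3 * (#S * #T * #U) ≤ 5 * Fintype.card G := by
  rcases S.eq_empty_or_nonempty with rfl | hS
  · simp
  rcases T.eq_empty_or_nonempty with rfl | hTn
  · simp
  rcases U.eq_empty_or_nonempty with rfl | hUn
  · simp
  obtain ⟨S', T', U', htpp', -, h1T, h1U, hcS, hcT, hcU⟩ := exists_basic_tpp htpp hS hTn hUn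
  rw [← hcS, ← hcT, ← hcU]
  exact h.three_mul_volume_le_basic htpp' (by rw [hcT]; exact hT) (by rw [hcU]; exact hU) h1T h1U

/-- **No `⟨N, m, p⟩` with `m, p ≤ 3` beyond `Σ d³`:** if `5|G| < 3Nmp` then `G` does not realize `⟨N, m, p⟩`. [folklore] -/
theorem not_realizesTPP [Fintype G] [DecidableEq G] {N m p : ℕ} (hm : m ≤ 3) (hp : p ≤ 3)
    (hlt : 5 * Fintype.card G < 3 * (N * m * p)) :
    ¬ Literature.Computability.AlgebraicComplexity.RealizesTPP G N m p := by
  rintro ⟨S, T, U, hS, hT, hU, htpp⟩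
  have := h.three_mul_volume_le htpp (by omega) (by omega)
  rw [hS, hT, hU] at this
  omega

/-- **No `⟨N, 3, 3⟩` when `5|G| < 27N`**, in every ordering of the sizes (`RealizesTPP.rotate`). [folklore] -/
theorem not_realizesTPP_three_three [Fintype G] [DecidableEq G] (N : ℕ) (hlt : 5 * Fintype.card G < 27 * N) :
    ¬ Literature.Computability.AlgebraicComplexity.RealizesTPP G N 3 3 ∧
      ¬ Literature.Computability.AlgebraicComplexity.RealizesTPP G 3 N 3 ∧
        ¬ Literature.Computability.AlgebraicComplexity.RealizesTPP G 3 3 N := by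
  have h1 : ¬ Literature.Computability.AlgebraicComplexity.RealizesTPP G N 3 3 :=
    h.not_realizesTPP le_rfl le_rfl (by omega)
  exact ⟨h1, fun h' => h1 h'.rotate, fun h' => h1 h'.rotate.rotate⟩

omit h in
/-- Coordinates pass to `Q × A` for abelian `A` (the class is closed under such products). [folklore] -/
theorem prod {Q A : Type*} [Group Q] [CommGroup A] {c : Q} {κ ε : Q → ZMod 3} (h : Coord c κ ε) :
    Coord ((c, 1) : Q × A) (fun q => κ q.1) (fun q => ε q.1) := by
  refine ⟨Prod.ext (by simp [h.ccc]) (by simp), h.kap_c, fun g => h.sign g.1, fun g k => h.kap_mul g.1 k.1,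
    fun g k => h.eps_mul g.1 k.1, fun a b => ?_⟩
  obtain ⟨u, hu, e⟩ := h.comm a.1 b.1
  refine ⟨(u, 1), ?_, Prod.ext e (by rw [Prod.snd_mul, Prod.snd_mul, Prod.snd_mul, mul_one, mul_comm])⟩
  rcases hu with rfl | rfl | rfl
  · exact Or.inl rfl
  · exact Or.inr (Or.inl rfl)
  · exact Or.inr (Or.inr (Prod.ext rfl (mul_one _).symm))

end Coord

/-! ## Instances: `S₃`, `Dic₃`, and the census cell `(34, 3, 3) ∉ Dic₃ × C₁₅` -/

/-- Coordinate `κ` on `S₃ = D₃`: `r i ↦ i`, `sr i ↦ −i`. [folklore] -/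
def κD : DihedralGroup 3 → ZMod 3
  | DihedralGroup.r i => i
  | DihedralGroup.sr i => -i

/-- Sign on `S₃ = D₃`: rotations `+1`, reflections `−1`. [folklore] -/
def εD : DihedralGroup 3 → ZMod 3
  | DihedralGroup.r _ => 1
  | DihedralGroup.sr _ => -1

/-- `S₃ = D₃` has coordinates (`c = r 1`). [folklore] -/
theorem coord_dihedral3 : Coord (DihedralGroup.r 1 : DihedralGroup 3) κD εD := by
  unfold Coord; decide

/-- Coordinate `κ` on `Dic₃ = QuaternionGroup 3`: `a i ↦ i mod 3`, `xa i ↦ −i mod 3`. [folklore] -/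
def κQ : QuaternionGroup 3 → ZMod 3
  | QuaternionGroup.a i => ((i.val : ℕ) : ZMod 3)
  | QuaternionGroup.xa i => -((i.val : ℕ) : ZMod 3)

/-- Sign on `Dic₃`: `a i ↦ 1`, `xa i ↦ −1`. [folklore] -/
def εQ : QuaternionGroup 3 → ZMod 3
  | QuaternionGroup.a _ => 1
  | QuaternionGroup.xa _ => -1

/-- `Dic₃ = QuaternionGroup 3` has coordinates (`c = a 4`). [folklore] -/
theorem coord_quaternion3 : Coord (QuaternionGroup.a 4 : QuaternionGroup 3) κQ εQ := by
  unfold Coord; decide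

/-- **Law for `S₃ × A`** (`A` finite abelian): no `⟨N, 3, 3⟩` in any order when `30|A| < 27N` (the `S₃` box constant `10` of NR138,
here as an instance of the structural theorem). [folklore] -/
theorem S3_prod_no_tpp_three_three {A : Type*} [CommGroup A] [Fintype A] [DecidableEq A] (N : ℕ)
    (hlt : 30 * Fintype.card A < 27 * N) :
    ¬ Literature.Computability.AlgebraicComplexity.RealizesTPP (DihedralGroup 3 × A) N 3 3 ∧
      ¬ Literature.Computability.AlgebraicComplexity.RealizesTPP (DihedralGroup 3 × A) 3 N 3 ∧
        ¬ Literature.Computability.AlgebraicComplexity.RealizesTPP (DihedralGroup 3 × A) 3 3 N :=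
  coord_dihedral3.prod.not_realizesTPP_three_three N (by rw [Fintype.card_prod, DihedralGroup.card]; omega)

/-- **Law for `Dic₃ × A`** (`A` finite abelian): no `⟨N, 3, 3⟩` in any order when `60|A| < 27N` — the `Dic₃` box constant `20`
as an instance of the structural theorem. [folklore] -/
theorem Dic3_prod_no_tpp_three_three {A : Type*} [CommGroup A] [Fintype A] [DecidableEq A] (N : ℕ)
    (hlt : 60 * Fintype.card A < 27 * N) :
    ¬ Literature.Computability.AlgebraicComplexity.RealizesTPP (QuaternionGroup 3 × A) N 3 3 ∧
      ¬ Literature.Computability.AlgebraicComplexity.RealizesTPP (QuaternionGroup 3 × A) 3 N 3 ∧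
        ¬ Literature.Computability.AlgebraicComplexity.RealizesTPP (QuaternionGroup 3 × A) 3 3 N :=
  coord_quaternion3.prod.not_realizesTPP_three_three N (by rw [Fintype.card_prod, QuaternionGroup.card]; omega)

/-- Census cell `(34, 3, 3)` at order `180` in `Dic₃ × C₁₅` (`27·34 = 918 > 900 = 5·180`): not realized, in any order. [folklore] -/
theorem Dic3xC15_no_tpp_34_3_3 :
    ¬ Literature.Computability.AlgebraicComplexity.RealizesTPP (QuaternionGroup 3 × Multiplicative (ZMod 15)) 34 3 3 ∧
      ¬ Literature.Computability.AlgebraicComplexity.RealizesTPP (QuaternionGroup 3 × Multiplicative (ZMod 15)) 3 34 3 ∧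
        ¬ Literature.Computability.AlgebraicComplexity.RealizesTPP (QuaternionGroup 3 × Multiplicative (ZMod 15)) 3 3 34 :=
  Dic3_prod_no_tpp_three_three 34 (by simp)

end Summit.MatrixMultiplication.OmegaCensus.CentreIndexSix
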